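/-
Copyright (c) 2026 the pub-hodgecm-mathlib formalisation cell (harness21).  Prover seat hodgecm-mathlib-K2E2-p12 (g0), Track B «K2-LIT»,
engine E2 «ThetaExhaustionByRigidity», unit CAPTURE, 2026-09-03.  KERNEL module: THEOREMS ONLY (no definition, no named fact, no `sorry`,
no instance, no notation).
-/
import Summits.HodgeConjecture.HodgeConjecture.Theorems.K2E2CapHolThetaWitnessOfHolPair      -- ★ (β) `capHolThetaWitness_of_holThetaPair` (this seat, p854893; ★ B′, ★ SP by import)
import Summits.HodgeConjecture.HodgeConjecture.Theorems.F0P2sThetaPairsCotForms              -- ★ B⁗ `thetaPair_mem_holCotForms_of_arch`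
import Summits.HodgeConjecture.HodgeConjecture.Theorems.F0P2tThetaPairNeZeroOfFrame             -- ★ (N5) `thetaPair_ne_zero_of_archFixed_frame`
import Literature.AlgebraicGeometry.Liu2021.AdmissibleElement                              -- `IsAdmissibleElement`
import HarnessLib

-- As in the lineage (★ `ThetaLiftFromLineCharacters`, the K2E2 Capture module): statements over the theta-kernel datum elaborate to very large
-- types; elaborate sequentially.
set_option Elab.async false

/-!
# K2 ∕ E2 «ThetaExhaustionByRigidity», unit CAPTURE — socket #12R `sig_K2E2CapHolThetaWitnessOriented` CLOSED MODULO ONE DISPLAYED ARCHIMEDEAN ROW: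
# `capHolThetaWitnessOriented_of_archRowsGen : ‹ARCH-ROWS-GEN› → ‹#12R›` (O50-1 shape: the residual as a binder, the socket text as conclusion)

Cell hodgecm-mathlib (D-0151), FLOOR 0, Track B «K2-LIT» (21-frontier RULING «PUSH BOTH», REQUESTS l.72341), engine E2, crux item H413 =
stmt-HodgeConjecture-24833 (route `HCCMUnconditional`, no route verbs); socket module `Cruxes/H413/Lines/K2_E2_ThetaExhaustionByRigidity_Capture.lean` ED. 3
(5f5a466f73a422d8), socket #12R `sig_K2E2CapHolThetaWitnessOriented` :198–262 (= the withdrawn #12 + `ι ∈ hμ.cmType.1`, dealer K2E2-plan (g0) R8 re-cut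
2026-09-03T21:42:31Z; dealt to K2E2-p12).  Author K2E2-p12 (g0).  `--supports stmt-HodgeConjecture-24833 --as helper`; THEOREMS ONLY; imports ★ only (no `Lines`).

WHAT IS PROVED.  **`capHolThetaWitnessOriented_of_archRowsGen (hA : ‹ARCH-ROWS-GEN›) : ‹#12R›`** — the CONCLUSION is the text of `sig_K2E2CapHolThetaWitnessOriented`
TOKEN FOR TOKEN (so `theorem sig_K2E2CapHolThetaWitnessOriented := capHolThetaWitnessOriented_of_archRowsGen stub_archRowsGen` closes the socket modulo the
stub by δ); the HYPOTHESIS `hA` is the honest residual (α) of the E2 letter as ONE displayed text «ARCH-ROWS-GEN»: at every TEL frame with `ι ∈ Φ_μ`, `μ` of weight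
one, `a(2δ)⁻¹` `Φ_μ`-admissible, `χ`, for SOME Weil majorants `hρ` and SOME finite invariant open-positive Borel measure `μ_W` on `[U(⟨a⟩)]`, SOME pair
`φ = (φ₀, φ₁)` of archimedean Schwartz vectors and `j₀` satisfy (W) the cotangent `K_∞`-type of every theta pair `(x,j) ↦ Θ̃_{R_{e₁}(φ_j ⊗ Φ_f)}(charCM χ̃_χ)(g_𝔸⁻¹ x g_𝔸)`
along `cmArchSection L ι H T hT`, (K) its invariance under `cmCompactFactor L ι H T hT`, (H) its holomorphic germs, `R^∞_{e₁} φ_{j₀} ≠ 0`, and (E) `R^∞_{e₁} φ_{j₀}` is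
fixed by `U(⟨a⟩)(L⁺ ⊗ ℝ)` under the archimedean Weil representation at the `μ`-splitting — the binders `hW hK hH` of ★ B⁗
`F0P2sThetaPairsCotForms.thetaPair_mem_holCotForms_of_arch` and `hΦ hE` of ★ (N5) `F0P2tThetaPairNeZeroOfFrame.thetaPair_ne_zero_of_archFixed_frame`, verbatim.
This is [KonnoKonno2007, Thm. 5.4] ∕ [Liu2021, App. D Lem. D.2 (2), §D.1 Step 3] (the harmonic Gaussian of the admissible line) in the tree's function currency —
in tree today ONLY in model currency inside the P4 engine (★ `exists_holTheta_atFrame_of_chiN`, abstract `∃ θ` output); see the seat's memo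
`K2/K2E2-p12/g0/MISSTATED-sig_K2E2CapHolThetaWitness.K2E2-p12-g0.md` ADDENDUM 1 for the price.  PROOF: ★ (N5) gives `Φ_f` with the theta pair non-zero, ★ B⁗ makes
it a holomorphic cotangent form, ★ (β) `capHolThetaWitness_of_holThetaPair` (p854893) packages (`L²` class ≠ 0, receivers `IsHolCotangentAt` by ★ SP, finite component
by ★ B′ at the pinned `ιV`, `ιA` ↦ canonical by ★ `eq_cmAdelicFrameTransport_of_coe`).  The orientation binder `ι ∈ hμ.cmType.1`, the weight and the admissibility
are consumed by `hA` only (they are what makes the rows satisfiable).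
HONEST LABEL: HC_CM is proved only modulo the 7 printed citations (2 remaining named inputs: hLiu418 = stmt-HodgeConjecture-24832, h413 =
stmt-HodgeConjecture-24833) until rung 0 closes; this file discharges no printed citation — it isolates one.

## References
* [Liu2021] Y. Liu, *Fourier–Jacobi cycles and arithmetic relative trace formula*, Camb. J. Math. 9 (2021) = arXiv:2102.11518: proof of Prop. 4.13 Case 1
  (l. 2131–2141, p. 48) and «Conversely» (l. 2145–2149); Def. 4.11–4.12; App. D §D.1 Step 3, Lem. D.1, Lem. D.2 (2).
* [KonnoKonno2007] T. Konno, K. Konno, Kyushu J. Math. 61 (2007), Thm. 5.4 p. 75.  [GelbartRogawski1991] Invent. Math. 105 (1991), §3.2 p. 457, Prop. 3.1.1.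
* [Li1992] J.-S. Li, J. reine angew. Math. 428 (1992), Thm 2.1 (26).  [BorelJacquet1979] §4.2, §4.6.  [Borel1997] Thm. 2.13, §5.14, §8.4.  [Rallis1984] Thm. 1.2.2.
-/

set_option autoImplicit false
-- the mandated namespace has the single-problem summit's repeated segment (`HodgeConjecture.HodgeConjecture`)
set_option linter.dupNamespace false

noncomputable section

namespace Summit.HodgeConjecture.HodgeConjecture.Cruxes.H413.K2E2CapHolThetaWitnessOriented

open scoped TensorProduct Matrix Kronecker ComplexOrder ENNReal SchwartzMap Classical
open NumberField NumberField.InfinitePlace IsDedekindDomain MeasureTheory MulAction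
open Literature.NumberTheory Literature.NumberTheory.Automorphic Literature.NumberTheory.Automorphic.UnitaryGroup
open Literature.NumberTheory.Automorphic.UnitaryGroup.CotangentForms
open Literature.NumberTheory.Automorphic.Liu2021
open Literature.NumberTheory.Automorphic.Liu2021.Def411WeilCarriers
open Literature.NumberTheory.Automorphic.Liu2021.Def411WeilCarriersDoubling
open Literature.NumberTheory.Automorphic.IdeleClassGroup
open Literature.NumberTheory.GelbartRogawski1991 Literature.NumberTheory.GelbartRogawski1991.UnitaryDualPair
open Literature.NumberTheory.GelbartRogawski1991.UnitaryDualPair.WeilCoinv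
open Literature.NumberTheory.Weil1964
open Literature.RepresentationTheory Literature.RepresentationTheory.Liu2021
open Literature.RepresentationTheory.CompactGroups
open Literature.AlgebraicGeometry.ShimuraVarieties (BallForms.isPullbackCocycle_cotangentCocycle)
open Literature.Geometry.ComplexHyperbolic.BallModel (U21 x₀)
open Literature.AlgebraicGeometry.Liu2021 (IsAdmissibleElement)
open Summit.HodgeConjecture.CorCM
open Summit.HodgeConjecture.CorCM.Transposition
open Summit.HodgeConjecture.HodgeConjecture.Cruxes.H413
open Summit.HodgeConjecture.HodgeConjecture.Cruxes.H413.F0P2dSocketD (holCotFormSpectralProjection_holds)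
open Summit.HodgeConjecture.HodgeConjecture.Cruxes.H413.F0P3HolProjectionReduction (compactSpace_automorphicQuotient_cm four_le_finrank_of_two_le)

/-! ## The socket #12R modulo the archimedean row -/

set_option synthInstance.maxHeartbeats 400000 in
set_option maxHeartbeats 16000000 in
/-- **`sig_K2E2CapHolThetaWitnessOriented` ⟸ ARCH-ROWS-GEN.**  Hypothesis `hA` = the archimedean rows (W)(K)(H)(E) + `R^∞φ_{j₀} ≠ 0` for SOME theta data and SOME
archimedean pair at every positively oriented admissible frame (the binders of ★ B⁗ ∕ ★ (N5) verbatim); conclusion = the socket text VERBATIM.  ★ (N5) ▸ ★ B⁗ ▸ ★ (β).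
[cite: Liu2021, proof of Prop. 4.13 Case 1 (l. 2131–2141) and «Conversely» (l. 2145–2149); App. D Lem. D.2 (2), §D.1 Step 3] [cite: KonnoKonno2007, Thm. 5.4 p. 75]
[cite: Li1992, Thm 2.1 (26) p. 184] [cite: BorelJacquet1979, §4.2, §4.6] [cite: Borel1997, §5.14] -/
theorem capHolThetaWitnessOriented_of_archRowsGen
    (hA :
      ∀ (L : Type) [Field L] [NumberField L] [IsCMField L] (ι : L →+* ℂ) (H : Matrix (Fin 3) (Fin 3) L) (T : GL (Fin 3) ℂ)
        (hT : (T : Matrix (Fin 3) (Fin 3) ℂ)ᴴ * H.map ι * (T : Matrix (Fin 3) (Fin 3) ℂ) = Literature.Geometry.ComplexHyperbolic.BallModel.J),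
        (∀ τ' : L →+* ℂ, InfinitePlace.mk τ' ≠ InfinitePlace.mk ι → (H.map τ').PosDef) → 2 ≤ Module.finrank ℚ ↥(maximalRealSubfield L) →
        ∀ {n' : ℕ} (e₁ : Fin 3 × Fin 1 ≃ Fin n') (dV : Fin 3 → L) (hdV : ∀ i, IsCMField.complexConj L (dV i) = dV i)
          (hdV0 : ∀ i, dV i ≠ 0) (g : GL (Fin 3) L)
          (hg : ((g : Matrix (Fin 3) (Fin 3) L).map (cmConjRingHom L))ᵀ * H * (g : Matrix (Fin 3) (Fin 3) L) = Matrix.diagonal dV)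
          (ιV : finAdelic (↥(maximalRealSubfield L)) L (IsCMField.complexConj L) 3 H →*
              finAdelic (↥(maximalRealSubfield L)) L (IsCMField.complexConj L) 3 (Matrix.diagonal dV)),
            (∀ k, ((ιV k : finAdelic (↥(maximalRealSubfield L)) L (IsCMField.complexConj L) 3 (Matrix.diagonal dV)) :
                GL (Fin 3) (FiniteAdeleRing (𝓞 L) L)) =
              (toFinAdeleGL L 3 g)⁻¹ * (k : GL (Fin 3) (FiniteAdeleRing (𝓞 L) L)) * toFinAdeleGL L 3 g) →
          ∀ [CompactSpace (↥(UnitaryGroup.adelic (↥(maximalRealSubfield L)) L (IsCMField.complexConj L) 3 (Matrix.diagonal dV)) ⧸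
              (UnitaryGroup.toAdelic (↥(maximalRealSubfield L)) L (IsCMField.complexConj L) 3 (Matrix.diagonal dV)).range)],
          ∀ (μ : Literature.NumberTheory.Automorphic.IdeleClassGroup L →ₜ* Circle) (hμ : IsConjugateSymplectic L μ), HasWeight L μ 1 →
            ι ∈ hμ.cmType.1 →
          ∀ (a : (↥(maximalRealSubfield L))ˣ) (χ : Chi (↥(maximalRealSubfield L)) L (IsCMField.complexConj L)),
              IsAdmissibleElement L hμ.cmType.1 (algebraMap (↥(maximalRealSubfield L)) L a * (2 * imagUnit L)⁻¹) →
              letI : MeasurableSpace (↥(UnitaryGroup.adelic (↥(maximalRealSubfield L)) L (IsCMField.complexConj L) 1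
                  (JW (↥(maximalRealSubfield L)) L a)) ⧸
                    (UnitaryGroup.toAdelic (↥(maximalRealSubfield L)) L (IsCMField.complexConj L) 1 (JW (↥(maximalRealSubfield L)) L a)).range) :=
                borel _
              ∃ (hρ : HasThetaMajorants fun
                  (p : ↥(UnitaryGroup.adelic (↥(maximalRealSubfield L)) L (IsCMField.complexConj L) 3 (Matrix.diagonal dV)) ×
                    ↥(UnitaryGroup.adelic (↥(maximalRealSubfield L)) L (IsCMField.complexConj L) 1 (JW (↥(maximalRealSubfield L)) L a)))
                  (Φ : piSchwartzBruhat (↥(maximalRealSubfield L)) (Fin n')) =>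
                    pairRep (↥(maximalRealSubfield L)) L (IsCMField.complexConj L) 3 1 e₁ (Matrix.diagonal dV) (JW (↥(maximalRealSubfield L)) L a)
                      (chiSplittingLine L e₁ dV hdV hdV0 (toHeckeCharacter L μ) (isUnitary_toHeckeCharacter L μ)
                        ((isOscillatorChar_toHeckeCharacter_iff μ).mpr hμ) (TW (↥(maximalRealSubfield L)) a)
                        (isUnit_det_TW (↥(maximalRealSubfield L)) a) (JW (↥(maximalRealSubfield L)) L a) (JW_eq (↥(maximalRealSubfield L)) L a))
                      p Φ)
                (μW : Measure (↥(UnitaryGroup.adelic (↥(maximalRealSubfield L)) L (IsCMField.complexConj L) 1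
                  (JW (↥(maximalRealSubfield L)) L a)) ⧸
                    (UnitaryGroup.toAdelic (↥(maximalRealSubfield L)) L (IsCMField.complexConj L) 1 (JW (↥(maximalRealSubfield L)) L a)).range))
                (_ : IsFiniteMeasure μW)
                (_ : SMulInvariantMeasure
                  (↥(UnitaryGroup.adelic (↥(maximalRealSubfield L)) L (IsCMField.complexConj L) 1 (JW (↥(maximalRealSubfield L)) L a)))
                  (↥(UnitaryGroup.adelic (↥(maximalRealSubfield L)) L (IsCMField.complexConj L) 1 (JW (↥(maximalRealSubfield L)) L a)) ⧸
                    (UnitaryGroup.toAdelic (↥(maximalRealSubfield L)) L (IsCMField.complexConj L) 1 (JW (↥(maximalRealSubfield L)) L a)).range)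
                  μW)
                (_ : μW.IsOpenPosMeasure)
                (φ : Fin 2 → 𝓢(((Fin 3 × Fin 1) → NumberField.mixedEmbedding.mixedSpace ↥(maximalRealSubfield L)), ℂ)) (j₀ : Fin 2),
                -- the rows (W) ∧ (K) ∧ (H) ∧ (R^∞φ_{j₀} ≠ 0) ∧ (E):
                -- (W) the cotangent `K_∞`-type along `cmArchSection`
                (haveI := normal_range_toAdelic_JW L a
                 ∀ (Φf : FinSB (↥(maximalRealSubfield L)) (Fin 3 × Fin 1)) (k : ↥(stabilizer (↥U21) x₀))
                    (x : (adelicGroupData (↥(maximalRealSubfield L)) L (IsCMField.complexConj L) 3 H).Adelic),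
                    (fun (j : Fin 2) =>
                      (lineThetaKernelDatum L 3 e₁ dV hdV hdV0 μ hμ a hρ).thetaLiftFun μW
                        (piSBReindex (↥(maximalRealSubfield L)) e₁
                          (piSchwartzBruhatEquiv (↥(maximalRealSubfield L)) (Fin 3 × Fin 1) (φ j ⊗ₜ[ℂ] Φf)))
                        (charCM (chiQuot (↥(maximalRealSubfield L)) L (IsCMField.complexConj L) (Algebra.IsQuadraticExtension.finrank_eq_two _ L)
                          (IsCMField.complexConj_ne_one (K := L)) a χ))
                        ((cmAdelicFrameTransport L 3 H dV g hg) (x * ((cmArchSection L ι H T hT).comp (stabilizer (↥U21) x₀).subtype) k))) =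
                      (BallForms.isPullbackCocycle_cotangentCocycle.weightOf x₀) k⁻¹ ((fun (j : Fin 2) =>
                      (lineThetaKernelDatum L 3 e₁ dV hdV hdV0 μ hμ a hρ).thetaLiftFun μW
                        (piSBReindex (↥(maximalRealSubfield L)) e₁
                          (piSchwartzBruhatEquiv (↥(maximalRealSubfield L)) (Fin 3 × Fin 1) (φ j ⊗ₜ[ℂ] Φf)))
                        (charCM (chiQuot (↥(maximalRealSubfield L)) L (IsCMField.complexConj L) (Algebra.IsQuadraticExtension.finrank_eq_two _ L)
                          (IsCMField.complexConj_ne_one (K := L)) a χ))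
                        ((cmAdelicFrameTransport L 3 H dV g hg) x)))) ∧
                -- (K) invariance under the compact archimedean factor
                (haveI := normal_range_toAdelic_JW L a
                 ∀ (Φf : FinSB (↥(maximalRealSubfield L)) (Fin 3 × Fin 1)), ∀ k ∈ cmCompactFactor L ι H T hT,
                    ∀ (x : (adelicGroupData (↥(maximalRealSubfield L)) L (IsCMField.complexConj L) 3 H).Adelic),
                    (fun (j : Fin 2) =>
                      (lineThetaKernelDatum L 3 e₁ dV hdV hdV0 μ hμ a hρ).thetaLiftFun μW
                        (piSBReindex (↥(maximalRealSubfield L)) e₁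
                          (piSchwartzBruhatEquiv (↥(maximalRealSubfield L)) (Fin 3 × Fin 1) (φ j ⊗ₜ[ℂ] Φf)))
                        (charCM (chiQuot (↥(maximalRealSubfield L)) L (IsCMField.complexConj L) (Algebra.IsQuadraticExtension.finrank_eq_two _ L)
                          (IsCMField.complexConj_ne_one (K := L)) a χ))
                        ((cmAdelicFrameTransport L 3 H dV g hg) (x * k))) = (fun (j : Fin 2) =>
                      (lineThetaKernelDatum L 3 e₁ dV hdV hdV0 μ hμ a hρ).thetaLiftFun μW
                        (piSBReindex (↥(maximalRealSubfield L)) e₁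
                          (piSchwartzBruhatEquiv (↥(maximalRealSubfield L)) (Fin 3 × Fin 1) (φ j ⊗ₜ[ℂ] Φf)))
                        (charCM (chiQuot (↥(maximalRealSubfield L)) L (IsCMField.complexConj L) (Algebra.IsQuadraticExtension.finrank_eq_two _ L)
                          (IsCMField.complexConj_ne_one (K := L)) a χ))
                        ((cmAdelicFrameTransport L 3 H dV g hg) x))) ∧
                -- (H) holomorphic germs along `cmArchSection`
                (haveI := normal_range_toAdelic_JW L a
                 ∀ (Φf : FinSB (↥(maximalRealSubfield L)) (Fin 3 × Fin 1)),
                    IsHolGerm (cmArchSection L ι H T hT) ((fun (x : (adelicGroupData (↥(maximalRealSubfield L)) L (IsCMField.complexConj L) 3 H).Adelic) (j : Fin 2) =>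
                      (lineThetaKernelDatum L 3 e₁ dV hdV hdV0 μ hμ a hρ).thetaLiftFun μW
                        (piSBReindex (↥(maximalRealSubfield L)) e₁
                          (piSchwartzBruhatEquiv (↥(maximalRealSubfield L)) (Fin 3 × Fin 1) (φ j ⊗ₜ[ℂ] Φf)))
                        (charCM (chiQuot (↥(maximalRealSubfield L)) L (IsCMField.complexConj L) (Algebra.IsQuadraticExtension.finrank_eq_two _ L)
                          (IsCMField.complexConj_ne_one (K := L)) a χ))
                        ((cmAdelicFrameTransport L 3 H dV g hg) x)))) ∧
                -- the archimedean vector `R^∞_{e₁} φ_{j₀}` is non-zero …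
                schwartzReindexCLM (↥(maximalRealSubfield L)) e₁ (φ j₀) ≠ 0 ∧
                -- (E) … and FIXED by `U(⟨a⟩)(L⁺ ⊗ ℝ)` under the archimedean Weil representation at the `μ`-splitting
                (∀ a' : UnitaryGroup.arch (↥(maximalRealSubfield L)) L (IsCMField.complexConj L) 1 (JW (↥(maximalRealSubfield L)) L a),
                  HodgeCM.Model.HypCensus.archWeilRep (↥(maximalRealSubfield L)) L (IsCMField.complexConj L) 3 1 (Matrix.diagonal dV)
                    (JW (↥(maximalRealSubfield L)) L a) (complexConj_imagUnit L) (imagUnit_ne_zero L) (imagUnit_mul_self L) (realDiagonal_isSymm L dV hdV)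
                    (isSymm_TW (↥(maximalRealSubfield L)) a) (isUnit_det_realDiagonal L dV hdV hdV0) (isUnit_det_TW (↥(maximalRealSubfield L)) a)
                    (realDiagonal_map L dV hdV).symm (JW_eq (↥(maximalRealSubfield L)) L a) e₁
                    (chiSplittingLine L e₁ dV hdV hdV0 (toHeckeCharacter L μ) (isUnitary_toHeckeCharacter L μ)
                      ((isOscillatorChar_toHeckeCharacter_iff μ).mpr hμ) (TW (↥(maximalRealSubfield L)) a)
                      (isUnit_det_TW (↥(maximalRealSubfield L)) a) (JW (↥(maximalRealSubfield L)) L a) (JW_eq (↥(maximalRealSubfield L)) L a))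
                    (ThetaNonvanishing.proj_apply_eq_toSp (↥(maximalRealSubfield L)) L (IsCMField.complexConj L) 3 1 e₁ (Matrix.diagonal dV)
                      (JW (↥(maximalRealSubfield L)) L a) (complexConj_imagUnit L) (imagUnit_ne_zero L) (imagUnit_mul_self L) (realDiagonal_isSymm L dV hdV)
                      (isSymm_TW (↥(maximalRealSubfield L)) a) (isUnit_det_realDiagonal L dV hdV hdV0) (isUnit_det_TW (↥(maximalRealSubfield L)) a)
                      (realDiagonal_map L dV hdV).symm (JW_eq (↥(maximalRealSubfield L)) L a)
                      (isCompatible_chiSplittingLine L e₁ dV hdV hdV0 (toHeckeCharacter L μ) (isUnitary_toHeckeCharacter L μ)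
                        ((isOscillatorChar_toHeckeCharacter_iff μ).mpr hμ) (TW (↥(maximalRealSubfield L)) a) (isSymm_TW (↥(maximalRealSubfield L)) a)
                        (isUnit_det_TW (↥(maximalRealSubfield L)) a) (JW (↥(maximalRealSubfield L)) L a) (JW_eq (↥(maximalRealSubfield L)) L a)))
                    (1, a') (schwartzReindexCLM (↥(maximalRealSubfield L)) e₁ (φ j₀)) = schwartzReindexCLM (↥(maximalRealSubfield L)) e₁ (φ j₀))) :
    ∀ (L : Type) [Field L] [NumberField L] [IsCMField L] (ι : L →+* ℂ) (H : Matrix (Fin 3) (Fin 3) L) (T : GL (Fin 3) ℂ)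
      (hT : (T : Matrix (Fin 3) (Fin 3) ℂ)ᴴ * H.map ι * (T : Matrix (Fin 3) (Fin 3) ℂ) = Literature.Geometry.ComplexHyperbolic.BallModel.J),
      (∀ τ' : L →+* ℂ, InfinitePlace.mk τ' ≠ InfinitePlace.mk ι → (H.map τ').PosDef) → 2 ≤ Module.finrank ℚ ↥(maximalRealSubfield L) →
      ∀ {n' : ℕ} (e₁ : Fin 3 × Fin 1 ≃ Fin n') (dV : Fin 3 → L) (hdV : ∀ i, IsCMField.complexConj L (dV i) = dV i)
        (hdV0 : ∀ i, dV i ≠ 0) (g : GL (Fin 3) L)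
        (hg : ((g : Matrix (Fin 3) (Fin 3) L).map (cmConjRingHom L))ᵀ * H * (g : Matrix (Fin 3) (Fin 3) L) = Matrix.diagonal dV)
        (ιA : (adelicGroupData (↥(maximalRealSubfield L)) L (IsCMField.complexConj L) 3 H).Adelic →*
            ↥(UnitaryGroup.adelic (↥(maximalRealSubfield L)) L (IsCMField.complexConj L) 3 (Matrix.diagonal dV))),
          (∀ k, ((ιA k : ↥(UnitaryGroup.adelic (↥(maximalRealSubfield L)) L (IsCMField.complexConj L) 3 (Matrix.diagonal dV))) :
                GL (Fin 3) (AdeleRing (𝓞 L) L)) =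
              (toAdeleGL L g)⁻¹ * adelicVal (↥(maximalRealSubfield L)) L (IsCMField.complexConj L) 3 H k * toAdeleGL L g) →
        ∀ (ιV : finAdelic (↥(maximalRealSubfield L)) L (IsCMField.complexConj L) 3 H →*
            finAdelic (↥(maximalRealSubfield L)) L (IsCMField.complexConj L) 3 (Matrix.diagonal dV)),
          (∀ k, ((ιV k : finAdelic (↥(maximalRealSubfield L)) L (IsCMField.complexConj L) 3 (Matrix.diagonal dV)) :
              GL (Fin 3) (FiniteAdeleRing (𝓞 L) L)) =
            (toFinAdeleGL L 3 g)⁻¹ * (k : GL (Fin 3) (FiniteAdeleRing (𝓞 L) L)) * toFinAdeleGL L 3 g) →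
        ∀ [CompactSpace (↥(UnitaryGroup.adelic (↥(maximalRealSubfield L)) L (IsCMField.complexConj L) 3 (Matrix.diagonal dV)) ⧸
            (UnitaryGroup.toAdelic (↥(maximalRealSubfield L)) L (IsCMField.complexConj L) 3 (Matrix.diagonal dV)).range)],
        ∀ (μA : Measure (adelicGroupData (↥(maximalRealSubfield L)) L (IsCMField.complexConj L) 3 H).automorphicQuotient)
          [(adelicGroupData (↥(maximalRealSubfield L)) L (IsCMField.complexConj L) 3 H).IsAutomorphicMeasure μA]
          (μ : Literature.NumberTheory.Automorphic.IdeleClassGroup L →ₜ* Circle) (hμ : IsConjugateSymplectic L μ), HasWeight L μ 1 →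
          ι ∈ hμ.cmType.1 →
          ∀ (a : (↥(maximalRealSubfield L))ˣ) (χ : Chi (↥(maximalRealSubfield L)) L (IsCMField.complexConj L)),
            IsAdmissibleElement L hμ.cmType.1 (algebraMap (↥(maximalRealSubfield L)) L a * (2 * imagUnit L)⁻¹) →
            letI : MeasurableSpace (↥(UnitaryGroup.adelic (↥(maximalRealSubfield L)) L (IsCMField.complexConj L) 1
                (JW (↥(maximalRealSubfield L)) L a)) ⧸
                  (UnitaryGroup.toAdelic (↥(maximalRealSubfield L)) L (IsCMField.complexConj L) 1 (JW (↥(maximalRealSubfield L)) L a)).range) :=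
              borel _
            ∃ (hρ : HasThetaMajorants fun
                (p : ↥(UnitaryGroup.adelic (↥(maximalRealSubfield L)) L (IsCMField.complexConj L) 3 (Matrix.diagonal dV)) ×
                  ↥(UnitaryGroup.adelic (↥(maximalRealSubfield L)) L (IsCMField.complexConj L) 1 (JW (↥(maximalRealSubfield L)) L a)))
                (Φ : piSchwartzBruhat (↥(maximalRealSubfield L)) (Fin n')) =>
                  pairRep (↥(maximalRealSubfield L)) L (IsCMField.complexConj L) 3 1 e₁ (Matrix.diagonal dV) (JW (↥(maximalRealSubfield L)) L a)
                    (chiSplittingLine L e₁ dV hdV hdV0 (toHeckeCharacter L μ) (isUnitary_toHeckeCharacter L μ)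
                      ((isOscillatorChar_toHeckeCharacter_iff μ).mpr hμ) (TW (↥(maximalRealSubfield L)) a)
                      (isUnit_det_TW (↥(maximalRealSubfield L)) a) (JW (↥(maximalRealSubfield L)) L a) (JW_eq (↥(maximalRealSubfield L)) L a))
                    p Φ)
              (μW : Measure (↥(UnitaryGroup.adelic (↥(maximalRealSubfield L)) L (IsCMField.complexConj L) 1
                (JW (↥(maximalRealSubfield L)) L a)) ⧸
                  (UnitaryGroup.toAdelic (↥(maximalRealSubfield L)) L (IsCMField.complexConj L) 1 (JW (↥(maximalRealSubfield L)) L a)).range))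
              (_ : IsFiniteMeasure μW)
              (_ : SMulInvariantMeasure
                (↥(UnitaryGroup.adelic (↥(maximalRealSubfield L)) L (IsCMField.complexConj L) 1 (JW (↥(maximalRealSubfield L)) L a)))
                (↥(UnitaryGroup.adelic (↥(maximalRealSubfield L)) L (IsCMField.complexConj L) 1 (JW (↥(maximalRealSubfield L)) L a)) ⧸
                  (UnitaryGroup.toAdelic (↥(maximalRealSubfield L)) L (IsCMField.complexConj L) 1 (JW (↥(maximalRealSubfield L)) L a)).range)
                μW)
              (f : C(↥(UnitaryGroup.adelic (↥(maximalRealSubfield L)) L (IsCMField.complexConj L) 1 (JW (↥(maximalRealSubfield L)) L a)) ⧸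
                (UnitaryGroup.toAdelic (↥(maximalRealSubfield L)) L (IsCMField.complexConj L) 1 (JW (↥(maximalRealSubfield L)) L a)).range, ℂ))
              (Φ : piSchwartzBruhat (↥(maximalRealSubfield L)) (Fin n'))
              (hθ : MemLp (toQuotFun (adelicGroupData (↥(maximalRealSubfield L)) L (IsCMField.complexConj L) 3 H) fun x =>
                (lineThetaKernelDatum L 3 e₁ dV hdV hdV0 μ hμ a hρ).thetaLiftFun μW Φ f (ιA x)) 2 μA),
              MemLp.toLp _ hθ ≠ 0 ∧
              ∀ P' : DiscreteAutomorphicRep (adelicGroupData (↥(maximalRealSubfield L)) L (IsCMField.complexConj L) 3 H) μA,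
                P'.space.toSubmodule.starProjection (MemLp.toLp _ hθ) ≠ 0 →
                P'.IsHolCotangentAt (cmArchSection L ι H T hT) (cmCompactFactor L ι H T hT) ∧
                P'.HasFinComponent
                  (rhoAtLine (↥(maximalRealSubfield L)) L (IsCMField.complexConj L) 3 e₁ (Matrix.diagonal dV)
                    (complexConj_imagUnit L) (imagUnit_ne_zero L) (imagUnit_mul_self L) (realDiagonal_isSymm L dV hdV)
                    (isUnit_det_realDiagonal L dV hdV hdV0) (realDiagonal_map L dV hdV).symm
                    (fun a => isCompatible_chiSplittingLine L e₁ dV hdV hdV0 (toHeckeCharacter L μ)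
                      (isUnitary_toHeckeCharacter L μ) ((isOscillatorChar_toHeckeCharacter_iff μ).mpr hμ)
                      (TW (↥(maximalRealSubfield L)) a) (isSymm_TW (↥(maximalRealSubfield L)) a)
                      (isUnit_det_TW (↥(maximalRealSubfield L)) a) (JW (↥(maximalRealSubfield L)) L a)
                      (JW_eq (↥(maximalRealSubfield L)) L a)) ιV a χ) := by
  intro L _ _ _ ι H T hT hpos h2 n' e₁ dV hdV hdV0 g hg ιA hιA ιV hιV _ μA _ μ hμ hw hι a χ hadm
  letI : MeasurableSpace (↥(UnitaryGroup.adelic (↥(maximalRealSubfield L)) L (IsCMField.complexConj L) 1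
      (JW (↥(maximalRealSubfield L)) L a)) ⧸
        (UnitaryGroup.toAdelic (↥(maximalRealSubfield L)) L (IsCMField.complexConj L) 1 (JW (↥(maximalRealSubfield L)) L a)).range) :=
    borel _
  haveI : BorelSpace (↥(UnitaryGroup.adelic (↥(maximalRealSubfield L)) L (IsCMField.complexConj L) 1
      (JW (↥(maximalRealSubfield L)) L a)) ⧸
        (UnitaryGroup.toAdelic (↥(maximalRealSubfield L)) L (IsCMField.complexConj L) 1 (JW (↥(maximalRealSubfield L)) L a)).range) :=
    ⟨rfl⟩
  haveI := normal_range_toAdelic_JW L a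
  -- the archimedean row at this frame
  obtain ⟨hρ, μW, hfinW, hinvW, hposW, φ, j₀, hW, hK, hH, hΦ, hE⟩ := hA L ι H T hT hpos h2 e₁ dV hdV hdV0 g hg ιV hιV μ hμ hw hι a χ hadm
  haveI : IsFiniteMeasure μW := hfinW
  haveI := hinvW
  haveI := hposW
  -- ★ (N5): some `Φ_f` makes the theta pair non-zero
  obtain ⟨Φf, hne⟩ := F0P2tThetaPairNeZeroOfFrame.thetaPair_ne_zero_of_archFixed_frame L ι H T hT hpos dV hdV g hg h2 e₁ hdV0 μ hμ a hρ μW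
    χ φ j₀ hΦ hE
  obtain ⟨x₁, hx₁⟩ := Function.ne_iff.mp hne
  obtain ⟨j₁, hj₁⟩ := Function.ne_iff.mp hx₁
  -- ★ B⁗: the pair is a holomorphic cotangent form; ★ (β) packages at the pinned transports
  exact K2E2CapHolThetaWitness.capHolThetaWitness_of_holThetaPair L ι H T hT hpos h2 e₁ dV hdV hdV0 g hg ιA hιA ιV hιV μA μ hμ a χ hρ μW
    hfinW hinvW φ Φf j₁
    (F0P2sThetaPairsCotForms.thetaPair_mem_holCotForms_of_arch L ι H T hT e₁ dV hdV hdV0 g hg ιV hιV μ hμ a χ hρ μW φ Φf (hW Φf) (hK Φf)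
      (hH Φf))
    ⟨x₁, hj₁⟩

end Summit.HodgeConjecture.HodgeConjecture.Cruxes.H413.K2E2CapHolThetaWitnessOriented

end
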